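import Mathlib
import Literature.MathematicalPhysics.QuantumFieldTheory.Balaban1983to89.GaussianSmallField
import Summits.QuantumFields.BalabanUV.Beta.CutoffVariant316

/-!
# Beta / CutoffTail332 — BINDER-OWNERS row D4, co-owner road P2′: the GAUSSIAN TAIL of one fluctuation bond outside
# [Balaban1988Convergent]'s cut-off box (3.16), and its comparison with powers of the coupling — the small factor behind
# the cut-off term of (3.32)/(3.37) — in kernel form over Mathlib's multivariate Gaussian
# (β sub-cell, unit `b2b-balaban-beta-d4-p2`, generation 1; NODE χ (leaf χ.1 + its crossover with C/T.2) of
# `HOME/beta/skeletons/D4-b2b-balaban-beta-d4-p2.md`)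

HONEST FRAMING (page 1 of everything the β sub-cell writes): discharging `BetaPertH` makes Bałaban's UV stability
UNCONDITIONAL — a real constructive-QFT result; it is NOT the continuum limit and NOT the Clay problem.  HONEST DEPENDENCY
(cell reorg 2026-08-19, verbatim): «continuum YM on T⁴ ⇐ BetaPertH ∧ nine spine estimates (0/9 proved); BetaPertH ⇐ (D1) ∧
(D4) ∧ CAP+tail; G-an2-4 gates asym, D1 and NE2/3/4.»  THIS MODULE INSTANTIATES NO BINDER AND ASSERTS NOTHING ABOUT
BAŁABAN'S MEASURES: it is measure theory over Mathlib's `ProbabilityTheory.multivariateGaussian` — a coordinate tail by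
measure preservation + the one-site Chernoff tail of the tree's `GaussianSmallField` (Mathlib-only leaf of the cell), a
finite union bound, and the elementary crossover of `CutoffVariant316.cutoffTail_le_pow` — proved from those UNMODIFIED
modules BY NAME, no `sorry`, no new axiom.

ABSOLUTE RULE (cell charter, verbatim): "No internally-minted statement may enter as a cited fact. Every hypothesis is
either kernel-proved in this package or a verbatim quotation of a PUBLISHED theorem with page reference. The manuscript(s)
under audit are NOT citable for their own disputed steps — they are the thing under adjudication; programme-internal
(2001/route/tribunal) claims are never citable."  Nothing is cited as a fact here.

## The printed text and what is typed

[III] = [Balaban1988Convergent], CMP **119**: the cut-off (3.16) p. 268 restricts EACH fluctuation bond variable,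
«χ({|[…g_kA_k](b)| < δ_k})», δ_k = g_kA₁/A₀·p₀(g_k) ((3.4) p. 265), i.e. on the unit-covariance variable `|A(b)| < r_k`,
`r_k = A₁(log g_k⁻²)^{p₀}` (cell GAPS G-adv6-14a); the cut-off term of (3.37) is (3.32) p. 273 «log∫dμχ₁^{(k)} = ∫₀¹dt ∫dμ
(∂/∂t χ_t^{(k)})(∫dμ χ_t^{(k)})⁻¹», bounded in print only by «(I.1.18)» (p. 278 ll. 19–27) and by the cell's reader-level
certification C-adv5-22 (c) by the Gaussian tail `μ(‖X‖ ≥ r_k) ≤ 2^{n/2}e^{−r_k²/(4σ²)}` per bond, «E₀-FREE, and SMALLER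
THAN ANY POWER of g_k».  TYPED here, for Mathlib's `multivariateGaussian μ S` on `EuclideanSpace ℝ ι` (ι = all
coordinates of all bonds; a bond b = a finite set `I` of `n = dim 𝔤` coordinates; `S i i ≤ C` the one-site variances —
[III] p. 273's spectral bound `σ² ≤ λ₀⁻¹`):
* §1 `coord_tail_eq` / `coord_tail_le`: `P(|x i − μ i| ≥ p) ≤ 2e^{−p²/(2C)}` per coordinate (measure preservation of the
  coordinate map + `GaussianSmallField.gaussianReal_real_abs_sub_mean_ge_le`);
* §2 `bond_tail_le`: `P(∃ i ∈ I, |x i − μ i| ≥ p) ≤ 2·|I|·e^{−p²/(2C)}` — ONE LARGE-FIELD BOND costs a Gaussian tail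
  (sup-norm reading of `|A(b)| ≥ r`; the union bound replaces C-adv5-22's Euclidean Chernoff `2^{n/2}e^{−r²/(4σ²)}`, same
  shape);
* §3 `bond_tail_le_pow`: with `p = r(g) = p0Profile A₁ p₀ g` ([III]'s cut-off radius, tree definition) and mean 0:
  `P(bond b leaves the box) ≤ 2·|I|·g^m` for every `m` and all `0 < g ≤ γ_T(1/(2C), A₁, p₀, m)` — the cut-off term's
  small factor is smaller than any power of the coupling, with the EXPLICIT threshold of `CutoffVariant316.gammaT`.
NOT typed here (remaining part of skeleton leaf χ, = χ.2/χ.4): the Mayer expansion of `Π_b χ_b` with one differentiated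
factor and its anchored resummation into localized terms with tree decay ([II] (2.3)/(2.5) mechanism) — the same kind of
second resummation as R.3.  NOT CLAIMED: anything about Bałaban's χ^{(k)} beyond this; NOT BetaPertH, NOT continuum,
NOT Clay.
-/

namespace Summit.QuantumFields.BalabanUV.Beta.CutoffTail332

open MeasureTheory ProbabilityTheory
open scoped NNReal ENNReal
open Literature.MathematicalPhysics.QuantumFieldTheory.Balaban1983to89
open Literature.MathematicalPhysics.QuantumFieldTheory.Balaban1983to89.GaussianSmallField
open Summit.QuantumFields.BalabanUV.Beta.CutoffVariant316

noncomputable section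

variable {ι : Type*} [Fintype ι] [DecidableEq ι]

/-! ## §1 One coordinate: the tail outside the slab is the one-dimensional Gaussian tail -/

/-- The coordinate TAIL of the multivariate Gaussian is the one-dimensional Gaussian tail (measure preservation of
`x ↦ x i`, as in `GaussianSmallField.multivariateGaussian_real_coord_abs_sub_le` for the slab). -/
theorem coord_tail_eq {μ : EuclideanSpace ℝ ι} {S : Matrix ι ι ℝ} (hS : S.PosSemidef) (i : ι) (p : ℝ) :
    (multivariateGaussian μ S).real {x | p ≤ |x i - μ i|} =
      (gaussianReal (μ i) (S i i).toNNReal).real {y : ℝ | p ≤ |y - μ i|} := by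
  have hmp := measurePreserving_eval_multivariateGaussian (μ := μ) hS (i := i)
  have hmeas : MeasurableSet {y : ℝ | p ≤ |y - μ i|} := measurableSet_le (by fun_prop) (by fun_prop)
  have h := hmp.measure_preimage hmeas.nullMeasurableSet
  have hset : {x : EuclideanSpace ℝ ι | p ≤ |x i - μ i|} =
      (fun x : EuclideanSpace ℝ ι => x i) ⁻¹' {y : ℝ | p ≤ |y - μ i|} := rfl
  rw [measureReal_def, measureReal_def, hset, h]

/-- **One coordinate outside the slab costs a Gaussian tail**: `P(|x i − μ i| ≥ p) ≤ 2·e^{−p²/(2C)}` whenever the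
one-site variance obeys `S i i ≤ C` (`C > 0`, `p ≥ 0`). -/
theorem coord_tail_le {μ : EuclideanSpace ℝ ι} {S : Matrix ι ι ℝ} (hS : S.PosSemidef) {C p : ℝ} (hC : 0 < C)
    {i : ι} (hSC : S i i ≤ C) (hp : 0 ≤ p) :
    (multivariateGaussian μ S).real {x | p ≤ |x i - μ i|} ≤ 2 * Real.exp (-(p ^ 2 / (2 * C))) := by
  rw [coord_tail_eq hS i p]
  have hv : (((S i i).toNNReal : ℝ≥0) : ℝ) ≤ C := by
    rw [Real.coe_toNNReal']
    exact max_le hSC hC.le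
  exact gaussianReal_real_abs_sub_mean_ge_le hC hv hp

/-! ## §2 One bond = finitely many coordinates: the union bound -/

omit [Fintype ι] [DecidableEq ι] in
/-- The «bond leaves the box» event as a finite union of coordinate tails. -/
theorem setOf_exists_eq_biUnion (μ : EuclideanSpace ℝ ι) (I : Finset ι) (p : ℝ) :
    {x : EuclideanSpace ℝ ι | ∃ i ∈ I, p ≤ |x i - μ i|} = ⋃ i ∈ I, {x | p ≤ |x i - μ i|} := by
  ext x; simp

/-- **ONE LARGE-FIELD BOND COSTS A GAUSSIAN TAIL**: for a finite set `I` of coordinates (the `n = dim 𝔤` components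
of one bond variable) with one-site variances `≤ C`:  `P(∃ i ∈ I, |x i − μ i| ≥ p) ≤ 2·|I|·e^{−p²/(2C)}`. -/
theorem bond_tail_le {μ : EuclideanSpace ℝ ι} {S : Matrix ι ι ℝ} (hS : S.PosSemidef) {C p : ℝ} (hC : 0 < C)
    (I : Finset ι) (hSC : ∀ i ∈ I, S i i ≤ C) (hp : 0 ≤ p) :
    (multivariateGaussian μ S).real {x | ∃ i ∈ I, p ≤ |x i - μ i|} ≤
      2 * (I.card : ℝ) * Real.exp (-(p ^ 2 / (2 * C))) := by
  rw [setOf_exists_eq_biUnion]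
  calc (multivariateGaussian μ S).real (⋃ i ∈ I, {x | p ≤ |x i - μ i|})
      ≤ ∑ i ∈ I, (multivariateGaussian μ S).real {x | p ≤ |x i - μ i|} := measureReal_biUnion_finset_le I _
    _ ≤ ∑ i ∈ I, 2 * Real.exp (-(p ^ 2 / (2 * C))) := Finset.sum_le_sum fun i hi => coord_tail_le hS hC (hSC i hi) hp
    _ = 2 * (I.card : ℝ) * Real.exp (-(p ^ 2 / (2 * C))) := by
        rw [Finset.sum_const, nsmul_eq_mul]; ring

/-! ## §3 With [III]'s cut-off radius: the tail is smaller than any power of the coupling, explicit threshold -/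

/-- **THE CUT-OFF TAIL VERSUS POWERS OF THE COUPLING.**  For the mean-zero Gaussian fluctuation measure with one-site
variances `≤ C`, [III]'s cut-off radius `r(g) = p0Profile A₁ p₀ g = A₁(log g⁻²)^{p₀}` ((3.16)/(3.4); `A₁ > 0`, `p₀ ≥ 1`),
a bond `I` and ANY power `m`:  for `0 < g ≤ γ_T := CutoffVariant316.gammaT (1/(2C)) A₁ p₀ m` (explicit),
`P(bond I leaves the cut-off box) ≤ 2·|I|·g^m` — GAPS C-adv5-22 (c)'s «smaller than any power of g_k» with the «once
log g_k⁻² is large» made an explicit γ-clause (γ last in the printed order of constants). -/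
theorem bond_tail_le_pow {S : Matrix ι ι ℝ} (hS : S.PosSemidef) {C : ℝ} (hC : 0 < C) (I : Finset ι)
    (hSC : ∀ i ∈ I, S i i ≤ C) {A₁ : ℝ} (hA₁ : 0 < A₁) {p₀ : ℕ} (hp₀ : 1 ≤ p₀) (m : ℕ) {g : ℝ} (hg : 0 < g)
    (hgT : g ≤ gammaT (1 / (2 * C)) A₁ p₀ m) :
    (multivariateGaussian 0 S).real {x | ∃ i ∈ I, p0Profile A₁ p₀ g ≤ |x i|} ≤ 2 * (I.card : ℝ) * g ^ m := by
  have hlam : 0 < 1 / (2 * C) := by positivity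
  have hg1 : g ≤ 1 := by
    refine hgT.trans ?_
    unfold gammaT
    rw [Real.exp_le_one_iff]
    have : (1 : ℝ) ≤ max 1 (((m : ℝ) / (2 * (1 / (2 * C)) * A₁ ^ 2)) ^ (((2 * p₀ - 1 : ℕ) : ℝ)⁻¹)) := le_max_left _ _
    linarith
  have hr : 0 ≤ p0Profile A₁ p₀ g := p0Profile_nonneg hA₁.le p₀ hg hg1
  have htail := cutoffTail_le_pow hlam hA₁ hp₀ m hg hgT
  have h1 := bond_tail_le (μ := 0) hS hC I hSC hr
  have hset : {x : EuclideanSpace ℝ ι | ∃ i ∈ I, p0Profile A₁ p₀ g ≤ |x i|} =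
      {x : EuclideanSpace ℝ ι | ∃ i ∈ I, p0Profile A₁ p₀ g ≤ |x i - (0 : EuclideanSpace ℝ ι) i|} := by
    ext x; simp
  rw [hset]
  refine h1.trans ?_
  have hexp : Real.exp (-(p0Profile A₁ p₀ g ^ 2 / (2 * C))) = Real.exp (-(1 / (2 * C)) * p0Profile A₁ p₀ g ^ 2) := by
    congr 1; ring
  rw [hexp]
  have hI : (0 : ℝ) ≤ 2 * (I.card : ℝ) := by positivity
  exact mul_le_mul_of_nonneg_left htail hI

end

end Summit.QuantumFields.BalabanUV.Beta.CutoffTail332
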